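import Literature.AnabelianGeometry.EtaleTheta.Discharge.Sec1EvalAtNaturality
import HarnessLib

/-!
# [EtTh] Thm. 1.10, proof p. 256 "`γ` maps `τ` to …": the translated points are ANCHORED — their
# coordinates `Ü(σ₁^{−a}·τ) = u₁^a · Ü(τ)` are FORCED by the translation law of the coordinate class
# (K2 checklist item 5 (b) as a theorem; proof-only)

Mochizuki, *The étale theta function …*, Publ. RIMS **45** (2009), §1, Prop. 1.5 (ii)/(iii) p. 23
("`F̈¹/F̈² = … = Ẑ·log(Ü)`", "`a ∈ Z ≅ Π^tp_X/Π^tp_Y` acts on … as follows"), Def. 1.9 (i) p. 29, proof of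
Thm. 1.10 p. 30 [cite: MochizukiEtTh2009, Prop 1.5 (iii) p.23].  PROOF-ONLY sequel (abc-iut cell, prover
abc-iut-L2-d1 gen 4) of `Sec1EvalAtNaturality.lean` (p420910: translated points `τ_a := σ^{−a}·y` with
PRESCRIBED coordinates and natural evaluation, from `Prop15ii`).

THE POINT.  `Sec1EvalAtNaturality` had to PRESCRIBE the coordinates of the `τ_a` because abc-iut-L2-t1's
`NonCuspidalPoint` leaves `coord` free (this seat's `Sec1Prop14iiiValuesVacuity.lean`).  The interface
owner's repair ANCHORS a point by the printed sentence "the Kummer class of the coordinate function `Ü`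
restricted to `y` is the Kummer class of the value `Ü(y)`" — in the tree's terms
`evalAt_y((infl log Ü)|_y) = toKddHat (coord y)` (t1's field `evalAt_logUdd`; here the HYPOTHESIS `hanch`,
so this file does not depend on the new structure).  Under that anchoring the coordinate of a translated
point is no longer a choice: from ONE class-level translation law for the coordinate class under the
generator, `conj(σ₁)(infl log Ü) = infl log Ü · infl κ̈(u₁)` (`htrans`; print: the deck transformation of
`Y → X` multiplies `Ü` by `±q̈`, i.e. `u₁ = ±q̈` — Prop. 1.5 (iii) / "`F̈¹/F̈² = Ẑ·log(Ü)`"), we DERIVE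
* `conj_zpow_inflTheta_logUdd_eq` — `conj(σ₁^a)(infl log Ü) = infl log Ü · infl κ̈(u₁^a)` for all
  `a ∈ ℤ` (with `Prop15ii`: constant classes are fixed);
* **`exists_anchoredTranslatePoints_of_prop15ii`** — the translated points `τ_a` of p420910 with
  `coord(τ_a) := u₁^a · coord(y)` are ANCHORED: `evalAt_{τ_a}((infl log Ü)|_{τ_a}) = toKddHat (coord τ_a)`,
  together with naturality for every class and `Dpt(τ_a) = σ₁^{−a}·D_y·σ₁^{a}`.  So K2's item 5 (b)
  ("`Ü(τ_a) = (s q̈)^a·√−1`") is a THEOREM from {`Prop15ii`, `htrans` with `u₁ = s q̈`, `τ` anchored},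
  and the translated points qualify as anchored points for t1's corrected fact `Prop14iiiValuesAnchored`.

HONEST FRAMING: `htrans` (one printed sentence about the `Z`-action on `log(Ü)`) and `hanch` are explicit
hypotheses; nothing of [EtTh] is asserted; no side is taken on [IUTchIII] Cor. 3.12.
-/

namespace Literature.AnabelianGeometry.EtaleTheta

namespace MuTwoSetting

open Literature.AnabelianGeometry.SemiGraphs

variable {p : ℕ} [Fact p.Prime] (M : MuTwoSetting p)

/-- **Iterated translation law for the coordinate class.**  If the generator `σ₁` translates
`infl log(Ü)` by the constant class of `u₁` (`htrans`), then — all constant classes being fixed by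
`Π^tp_X` under `Prop15ii` (`F̈² = Im κ̈`, abc-iut-w5-d234's `conj_inflTheta_kumYdd_eq_self`) — `σ₁^a`
translates it by the constant class of `u₁^a`, for every `a ∈ ℤ` ("`a ∈ Z` acts …", Prop. 1.5 (iii)).
[cite: MochizukiEtTh2009, Prop 1.5 (iii) p.23] -/
theorem conj_zpow_inflTheta_logUdd_eq (hC : M.toThetaSetting.Compat) {E : M.toThetaSetting.KummerData}
    (h15ii : ThetaSetting.Prop15ii E hC) (σ₁ : M.PiTemp) (u₁ : (↥M.Kdd)ˣ)
    (htrans : haveI := hC.GtpYdd_normal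
      ContH1.conj M.toTheta M.toThetaSetting.DeltaTheta σ₁
          (M.toThetaSetting.inflTheta M.toThetaSetting.GtpYdd E.logUdd) =
        M.toThetaSetting.inflTheta M.toThetaSetting.GtpYdd E.logUdd *
          M.toThetaSetting.inflTheta M.toThetaSetting.GtpYdd (E.kumYdd (E.toKddHat u₁)))
    (a : ℤ) :
    haveI := hC.GtpYdd_normal
    ContH1.conj M.toTheta M.toThetaSetting.DeltaTheta (σ₁ ^ a)
        (M.toThetaSetting.inflTheta M.toThetaSetting.GtpYdd E.logUdd) =
      M.toThetaSetting.inflTheta M.toThetaSetting.GtpYdd E.logUdd *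
        M.toThetaSetting.inflTheta M.toThetaSetting.GtpYdd (E.kumYdd (E.toKddHat (u₁ ^ a))) := by
  haveI := hC.GtpYdd_normal
  -- abbreviations
  set L := M.toThetaSetting.inflTheta M.toThetaSetting.GtpYdd E.logUdd with hL
  set K : (↥M.Kdd)ˣ →* M.toThetaSetting.H1 M.toThetaSetting.GtpYdd :=
    ((M.toThetaSetting.inflTheta M.toThetaSetting.GtpYdd).comp E.kumYdd).comp E.toKddHat with hK
  have hK_apply : ∀ u : (↥M.Kdd)ˣ,
      K u = M.toThetaSetting.inflTheta M.toThetaSetting.GtpYdd (E.kumYdd (E.toKddHat u)) := fun u => rfl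
  -- constant classes are fixed by every element of `Π^tp_X`
  have hfix : ∀ (σ : M.PiTemp) (u : (↥M.Kdd)ˣ),
      ContH1.conj M.toTheta M.toThetaSetting.DeltaTheta σ (K u) = K u := fun σ u =>
    M.conj_inflTheta_kumYdd_eq_self hC E σ u (by rw [h15ii.Fdd2_eq]; exact ⟨_, rfl⟩)
  have htrans' : ContH1.conj M.toTheta M.toThetaSetting.DeltaTheta σ₁ L = L * K u₁ := htrans
  -- the inverse generator translates by `u₁⁻¹`
  have htrans_inv : ContH1.conj M.toTheta M.toThetaSetting.DeltaTheta σ₁⁻¹ L = L * K u₁⁻¹ := by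
    have h := congrArg (ContH1.conj M.toTheta M.toThetaSetting.DeltaTheta σ₁⁻¹) htrans'
    rw [ContH1.conj_inv_conj_apply, map_mul, hfix] at h
    -- `h : L = conj σ₁⁻¹ L * K u₁`
    rw [map_inv, eq_mul_inv_iff_mul_eq]
    exact h.symm
  -- the statement for all integers, by induction
  suffices H : ∀ a : ℤ, ContH1.conj M.toTheta M.toThetaSetting.DeltaTheta (σ₁ ^ a) L = L * K (u₁ ^ a) by
    have Ha := H a
    rw [hK_apply] at Ha
    exact Ha
  intro a
  induction a using Int.induction_on with
  | zero => rw [zpow_zero, zpow_zero, map_one, ContH1.conj_one_apply, mul_one]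
  | succ n ih =>
    rw [zpow_add_one, zpow_add_one, ContH1.conj_mul_apply, htrans', map_mul, ih, hfix, map_mul,
      mul_assoc]
  | pred n ih =>
    rw [zpow_sub_one, zpow_sub_one, ContH1.conj_mul_apply, htrans_inv, map_mul, ih, hfix, map_mul,
      mul_assoc]

/-- **ANCHORED translated points** (K2 checklist 5 (a) and 5 (b) together, from named inputs).  For a
`MuTwoSetting`, `Prop15ii`, a point `y` that is ANCHORED (`hanch`: `evalAt_y((infl log Ü)|_y) =
toKddHat (coord y)` — t1's `AnchoredPoint.evalAt_logUdd`), a generator `σ₁` with translation law `htrans`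
(`u₁ ∈ K̈^×`), and admissibility of the coordinates `coord(y)·u₁^a`: there are points `τ_a` with
`Dpt(τ_a) = σ₁^{−a}·D_y·σ₁^{a}`, `coord(τ_a) = coord(y)·u₁^a`, natural evaluation for every class, AND
the anchoring equation `evalAt_{τ_a}((infl log Ü)|_{τ_a}) = toKddHat (coord τ_a)` — the coordinate of the
translated point is the forced one ("`γ` maps `τ` to [the point with] `Ü = (±q̈)^a·Ü(τ)`", proof of
Thm. 1.10 p. 30, for `u₁ = ±q̈`). [cite: MochizukiEtTh2009, Def 1.9 (i) p.29] -/
theorem exists_anchoredTranslatePoints_of_prop15ii (hC : M.toThetaSetting.Compat)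
    {E : M.toThetaSetting.KummerData} (h15ii : ThetaSetting.Prop15ii E hC)
    (y : ThetaSetting.NonCuspidalPoint E)
    (hanch : y.evalAt (ContH1.res M.toTheta M.toThetaSetting.DeltaTheta y.Dpt_le
        (M.toThetaSetting.inflTheta M.toThetaSetting.GtpYdd E.logUdd)) = E.toKddHat y.coord)
    (σ₁ : M.PiTemp) (u₁ : (↥M.Kdd)ˣ)
    (htrans : haveI := hC.GtpYdd_normal
      ContH1.conj M.toTheta M.toThetaSetting.DeltaTheta σ₁
          (M.toThetaSetting.inflTheta M.toThetaSetting.GtpYdd E.logUdd) =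
        M.toThetaSetting.inflTheta M.toThetaSetting.GtpYdd E.logUdd *
          M.toThetaSetting.inflTheta M.toThetaSetting.GtpYdd (E.kumYdd (E.toKddHat u₁)))
    (hw : ∀ a b : ℤ, (((y.coord * u₁ ^ a : (↥M.Kdd)ˣ) : M.Kdd) : PadicAlgCl p) ≠ M.toThetaSetting.qdd ^ b ∧
      (((y.coord * u₁ ^ a : (↥M.Kdd)ˣ) : M.Kdd) : PadicAlgCl p) ≠ -(M.toThetaSetting.qdd ^ b)) :
    haveI := hC.GtpYdd_normal
    ∃ τ_ : ℤ → ThetaSetting.NonCuspidalPoint E,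
      (∀ a : ℤ, (τ_ a).Dpt = y.Dpt.comap (MulAut.conj (σ₁ ^ a)).toMonoidHom) ∧
      (∀ a : ℤ, (τ_ a).coord = y.coord * u₁ ^ a) ∧
      (∀ (a : ℤ) (x : M.toThetaSetting.H1 M.toThetaSetting.GtpYdd),
        y.evalAt (ContH1.res M.toTheta M.toThetaSetting.DeltaTheta y.Dpt_le
            (ContH1.conj M.toTheta M.toThetaSetting.DeltaTheta (σ₁ ^ a) x)) =
          (τ_ a).evalAt (ContH1.res M.toTheta M.toThetaSetting.DeltaTheta (τ_ a).Dpt_le x)) ∧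
      (∀ a : ℤ, (τ_ a).evalAt (ContH1.res M.toTheta M.toThetaSetting.DeltaTheta (τ_ a).Dpt_le
          (M.toThetaSetting.inflTheta M.toThetaSetting.GtpYdd E.logUdd)) = E.toKddHat (τ_ a).coord) := by
  haveI := hC.GtpYdd_normal
  obtain ⟨τ_, hD, hcoord, hnat⟩ :=
    M.exists_translatePoints_of_prop15ii hC h15ii y σ₁ (fun a => y.coord * u₁ ^ a) hw
  refine ⟨τ_, hD, hcoord, hnat, fun a => ?_⟩
  -- anchoring: evaluate the translated coordinate class via naturality, the translation law,
  -- the anchoring of `y` and `evalAt_kum`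
  rw [← hnat a, M.conj_zpow_inflTheta_logUdd_eq hC h15ii σ₁ u₁ htrans a, map_mul, map_mul, hanch,
    y.evalAt_kum, hcoord a, map_mul]

end MuTwoSetting

end Literature.AnabelianGeometry.EtaleTheta
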